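import Literature.AlgebraicGeometry.AbelianSchemes.SymplecticLevelPowDown
import HarnessLib

/-!
# A symplectic lift exists iff a symplectic similitude lifting `φ(s̄)` exists at every single level (König)
# ([Lan2013PELCompactifications, §1.3.6 Lemma 1.3.6.5 / Lemma 1.3.6.6]; cell hodgecm-mathlib, F-DAG (h9-S) piece (S1), file 2 of 2)

Layer `Literature/AlgebraicGeometry/AbelianSchemes`, namespace `Literature.AlgebraicGeometry.AbelianSchemes.AbelianSchemeOver`.
THEOREMS ONLY (no definition, no named fact, no instance, no `sorry`).

[Lan2013PELCompactifications, Lemma 1.3.6.5 (p. 81)]: a level-`n` structure is symplectic-liftable at the geometric point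
`s̄` when «there exists (noncanonically) [a] symplectic isomorphism `α̂ : L ⊗ Ẑ ⥲ T A_s̄` lifting `α_{n,s̄}`»; Lemma 1.3.6.6
(pp. 81–82) passes between `α̂` and its finite-level reductions «`(α_{m,s̄}, ν_{m,s̄}) : L/mL ⥲ A[m]_s̄`, `n ∣ m`».  In the
carrier ★ `AbelianSchemeSymplecticLevel` a symplectic lift `Λ : φ.SymplecticLift s Θ δ` IS such a compatible TOWER
`(ζ_M, lift_M)_{N ∣ M}` of primitive roots and symplectic similitudes `(ℤ/M)^{2g} ⥲ A_s[M](Ω)`.  Proved here: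

  `Nonempty (φ.SymplecticLift s Θ δ) ↔ ∀ k ≠ 0, ∃ (ζ, L) a level-kN symplectic similitude with L(eᵢ)^k = σᵢ(s)`

(`nonempty_symplecticLift_iff_forall_level`): a compatible tower exists as soon as a similitude lifting `φ(s)` exists at
EVERY SINGLE LEVEL, with no compatibility asked.  «⇒» forgets; «⇐» is KÖNIG's lemma on the cofinal chain of levels
`N·n!` (`exists_chain_of_forall_level`: the truncated compatible chains form an inverse system of FINITE non-empty sets —
finitely many primitive roots, finitely many maps into the finite group `A_s[N·j!](Ω)`; non-empty by powering the given
level-`N·n!` similitude down, ★ `SymplecticLevelPowDown` §1 — so ★ `exists_seq_of_forall_exists_chain` applies), followed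
by SPREADING the chain to every level `M` through `N·M!` (`nonempty_symplecticLift_of_chain`, `M ∣ M!`).  Consequently
★ `IsSymplecticLiftable` (the pointwise criterion of Lemma 1.3.6.6) is a LEVEL-BY-LEVEL condition
(`isSymplecticLiftable_iff_forall_level`) — which is what makes its transport along a connected base a finite-level
statement (piece (S2) of the cell's (h9-S); consumer F-6 (V′)).

Cell hodgecm-mathlib (D-0151), F-DAG second wave (h9) (price sheet `B-provers/B-p03/g16/F-DAG-PRICE` §5b (9)), symplectic
half (S1); B-plan1 (g15) 02:48:26Z.  Count-neutral capital; HC_CM is proved only modulo the 7 printed citations until rung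
0 closes — nothing here is about HC.

## References
* [Lan2013PELCompactifications] K.-W. Lan, *Arithmetic compactifications of PEL-type Shimura varieties*, LMS Monographs
  36 (2013), §1.3.6 Def. 1.3.6.2 (p. 80), Lemma 1.3.6.5 (p. 81), Lemma 1.3.6.6 and Cor. 1.3.6.7 (pp. 81–82).
* [Deligne1971TravauxShimura] P. Deligne, *Travaux de Shimura*, Sém. Bourbaki 389 (1971), 4.12 (b) (p. 149).
* D. Kőnig, *Über eine Schlussweise aus dem Endlichen ins Unendliche*, Acta Sci. Math. (Szeged) 3 (1927) 121–130.
* Tree: ★ `AbelianSchemeSymplecticLevel` (`SymplecticLift`, `IsSymplecticLiftable`, `typeFormMod`), ★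
  `SymplecticLevelPowDown` (power-down of a level datum, König on a chain, `factorial_pred_mul_mul_eq`).
-/

universe u

open CategoryTheory CategoryTheory.Limits AlgebraicGeometry MonoidalCategory

noncomputable section

namespace Literature.AlgebraicGeometry.AbelianSchemes

open Literature.AlgebraicGeometry.Motives Literature.AlgebraicGeometry.AbelianVarieties

open scoped MonObj

namespace AbelianSchemeOver

/-! ### A symplectic lift exists iff a symplectic similitude lifting `φ(s)` exists at every level -/

namespace LevelStructure

variable {S : Scheme.{u}} {A : AbelianSchemeOver S} {g N : ℕ} (φ : A.LevelStructure g N) {Ω : Type u} [Field Ω]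
  (s : Spec (.of Ω) ⟶ S) (Θ : CartierDivisor (A.fibre s).toAbelianVariety.X.left) (δ : Fin g → ℕ)

/-- **KÖNIG STEP — a compatible CHAIN of symplectic similitudes on the levels `N·j!`**: if `φ(s)` lifts to a symplectic
similitude at every single level `kN`, then there are primitive roots `ζ_j` of order `N·j!` and symplectic similitudes
`L_j : (ℤ/N·j!)^{2g} ⥲ A_s[N·j!](Ω)` lifting `φ(s)` (`L_j(eᵢ)^{j!} = σᵢ(s)`) which are COMPATIBLE along the chain:
`ζ_{j+1}^{j+1} = ζ_j` and `L_j(x mod N·j!) = L_{j+1}(x)^{j+1}`.  The truncated compatible chains form an inverse system of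
finite non-empty sets (finite: finitely many primitive roots, finitely many maps into `A_s[N·j!](Ω)`, which is finite as the
bijective image of `(ℤ/N·j!)^{2g}`; non-empty: power the given level-`N·n!` similitude down to each `j ≤ n`, §1), so §2
applies. [cite: Lan2013PELCompactifications, §1.3.6 Lemma 1.3.6.5 (p. 81) and Lemma 1.3.6.6 (pp. 81–82)] -/
theorem exists_chain_of_forall_level (hN : N ≠ 0)
    (h : ∀ k : ℕ, k ≠ 0 → ∃ (ζ : Ω) (L : Multiplicative (Fin g ⊕ Fin g → ZMod (k * N)) →*
          (A.fibre s).toAbelianVariety.torsionPoints Ω ((k * N : ℕ) : ℤ)),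
        IsPrimitiveRoot ζ (k * N) ∧ Function.Bijective L ∧
        (∀ i : Fin g ⊕ Fin g, ((L (Multiplicative.ofAdd (Pi.single i 1))) : (A.fibre s).toAbelianVariety.Points Ω) ^ k =
          A.restrictPt s (φ.σ i)) ∧
        ∀ (hMΩ : ((k * N : ℕ) : Ω) ≠ 0) (x y : Fin g ⊕ Fin g → ZMod (k * N)),
          haveI := AbelianVariety.isDominant_toSchemeHom_zsmul_of_ne_zero (A.fibre s).toAbelianVariety hMΩ
          (A.fibre s).toAbelianVariety.weilPairingLevel Θ (L (Multiplicative.ofAdd x)) (L (Multiplicative.ofAdd y)) =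
            ζ ^ (typeFormMod δ (k * N) x y).val) :
    ∃ (ζs : ℕ → Ω) (Ls : ∀ j : ℕ, Multiplicative (Fin g ⊕ Fin g → ZMod (j.factorial * N)) →*
        (A.fibre s).toAbelianVariety.torsionPoints Ω ((j.factorial * N : ℕ) : ℤ)),
      (∀ j : ℕ, IsPrimitiveRoot (ζs j) (j.factorial * N) ∧ Function.Bijective (Ls j) ∧
        (∀ i : Fin g ⊕ Fin g,
          ((Ls j (Multiplicative.ofAdd (Pi.single i 1))) : (A.fibre s).toAbelianVariety.Points Ω) ^ j.factorial =
            A.restrictPt s (φ.σ i)) ∧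
        ∀ (hMΩ : ((j.factorial * N : ℕ) : Ω) ≠ 0) (x y : Fin g ⊕ Fin g → ZMod (j.factorial * N)),
          haveI := AbelianVariety.isDominant_toSchemeHom_zsmul_of_ne_zero (A.fibre s).toAbelianVariety hMΩ
          (A.fibre s).toAbelianVariety.weilPairingLevel Θ (Ls j (Multiplicative.ofAdd x)) (Ls j (Multiplicative.ofAdd y)) =
            ζs j ^ (typeFormMod δ (j.factorial * N) x y).val) ∧
      ∀ j : ℕ, ζs (j + 1) ^ (j + 1) = ζs j ∧
        ∀ x : Fin g ⊕ Fin g → ZMod ((j + 1).factorial * N),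
          ((Ls j (Multiplicative.ofAdd fun i => ZMod.castHom
              (mul_dvd_mul_right (Nat.factorial_dvd_factorial (Nat.le_succ j)) N) (ZMod (j.factorial * N)) (x i))) :
            (A.fibre s).toAbelianVariety.Points Ω) =
          ((Ls (j + 1) (Multiplicative.ofAdd x)) : (A.fibre s).toAbelianVariety.Points Ω) ^ (j + 1) := by
  classical
  have hlev0 : ∀ j : ℕ, j.factorial * N ≠ 0 := fun j => Nat.mul_ne_zero (Nat.factorial_ne_zero j) hN
  -- the torsion at every level of the chain is finite (it is the bijective image of `(ℤ/N·j!)^{2g}`)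
  have hfin : ∀ j : ℕ, Finite ((A.fibre s).toAbelianVariety.torsionPoints Ω ((j.factorial * N : ℕ) : ℤ)) := fun j => by
    obtain ⟨-, L, -, hL, -, -⟩ := h j.factorial (Nat.factorial_ne_zero j)
    haveI : NeZero (j.factorial * N) := ⟨hlev0 j⟩
    exact Finite.of_surjective L hL.2
  -- the level data and their compatibility
  let Good : ∀ j : ℕ, Ω → (Multiplicative (Fin g ⊕ Fin g → ZMod (j.factorial * N)) →*
      (A.fibre s).toAbelianVariety.torsionPoints Ω ((j.factorial * N : ℕ) : ℤ)) → Prop := fun j ζ L =>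
    IsPrimitiveRoot ζ (j.factorial * N) ∧ Function.Bijective L ∧
      (∀ i : Fin g ⊕ Fin g,
        ((L (Multiplicative.ofAdd (Pi.single i 1))) : (A.fibre s).toAbelianVariety.Points Ω) ^ j.factorial =
          A.restrictPt s (φ.σ i)) ∧
      ∀ (hMΩ : ((j.factorial * N : ℕ) : Ω) ≠ 0) (x y : Fin g ⊕ Fin g → ZMod (j.factorial * N)),
        haveI := AbelianVariety.isDominant_toSchemeHom_zsmul_of_ne_zero (A.fibre s).toAbelianVariety hMΩ
        (A.fibre s).toAbelianVariety.weilPairingLevel Θ (L (Multiplicative.ofAdd x)) (L (Multiplicative.ofAdd y)) =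
          ζ ^ (typeFormMod δ (j.factorial * N) x y).val
  let X : ℕ → Type u := fun j => {p : Ω × (Multiplicative (Fin g ⊕ Fin g → ZMod (j.factorial * N)) →*
      (A.fibre s).toAbelianVariety.torsionPoints Ω ((j.factorial * N : ℕ) : ℤ)) // Good j p.1 p.2}
  let C : ∀ j : ℕ, X j → X (j + 1) → Prop := fun j p q =>
    q.1.1 ^ (j + 1) = p.1.1 ∧
      ∀ x : Fin g ⊕ Fin g → ZMod ((j + 1).factorial * N),
        ((p.1.2 (Multiplicative.ofAdd fun i => ZMod.castHom
            (mul_dvd_mul_right (Nat.factorial_dvd_factorial (Nat.le_succ j)) N) (ZMod (j.factorial * N)) (x i))) :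
          (A.fibre s).toAbelianVariety.Points Ω) =
        ((q.1.2 (Multiplicative.ofAdd x)) : (A.fibre s).toAbelianVariety.Points Ω) ^ (j + 1)
  haveI : ∀ j, Finite (X j) := fun j => by
    haveI := hfin j
    haveI : NeZero (j.factorial * N) := ⟨hlev0 j⟩
    have hprim : Finite {ζ : Ω // IsPrimitiveRoot ζ (j.factorial * N)} :=
      Finite.of_injective (fun z => (⟨z.1, (mem_primitiveRoots (Nat.pos_of_ne_zero (hlev0 j))).2 z.2⟩ :
          (primitiveRoots (j.factorial * N) Ω))) fun z z' hz => by
        apply Subtype.ext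
        have hz' := congrArg Subtype.val hz
        exact hz'
    refine Finite.of_injective (fun p : X j => ((⟨p.1.1, p.2.1⟩ : {ζ : Ω // IsPrimitiveRoot ζ (j.factorial * N)}),
        (p.1.2 : Multiplicative (Fin g ⊕ Fin g → ZMod (j.factorial * N)) →
          (A.fibre s).toAbelianVariety.torsionPoints Ω ((j.factorial * N : ℕ) : ℤ)))) fun p q hpq => ?_
    obtain ⟨h1, h2⟩ := Prod.mk.inj hpq
    exact Subtype.ext (Prod.ext (congrArg Subtype.val h1) (DFunLike.coe_injective h2))
  -- finite compatible strings of every length: power the level-`N·n!` similitude down to each `j ≤ n`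
  have hstr : ∀ n : ℕ, ∃ t : (j : Fin (n + 1)) → X j,
      ∀ (j : ℕ) (hj : j + 1 < n + 1), C j (t ⟨j, Nat.lt_of_succ_lt hj⟩) (t ⟨j + 1, hj⟩) := by
    intro n
    obtain ⟨ζ, L, hζ, hL, hlv, hpair⟩ := h n.factorial (Nat.factorial_ne_zero n)
    have hd : ∀ j, j ≤ n → n.factorial / j.factorial * j.factorial = n.factorial := fun j hj =>
      Nat.div_mul_cancel (Nat.factorial_dvd_factorial hj)
    have hd0 : ∀ j, j ≤ n → n.factorial / j.factorial ≠ 0 := fun j hj h0 => by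
      have h' := hd j hj
      rw [h0, zero_mul] at h'
      exact Nat.factorial_ne_zero n h'.symm
    have hdlev : ∀ j, j ≤ n → n.factorial / j.factorial * (j.factorial * N) = n.factorial * N := fun j hj => by
      rw [← mul_assoc, hd j hj]
    have hdS : ∀ j, j + 1 ≤ n → n.factorial / (j + 1).factorial * (j + 1) = n.factorial / j.factorial := fun j hj => by
      apply Nat.eq_of_mul_eq_mul_right (Nat.factorial_pos j)
      rw [mul_assoc, ← Nat.factorial_succ, hd (j + 1) hj, hd j (Nat.le_of_succ_le hj)]
    have hex : ∀ j : ℕ, ∃ L' : Multiplicative (Fin g ⊕ Fin g → ZMod (j.factorial * N)) →*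
        (A.fibre s).toAbelianVariety.torsionPoints Ω ((j.factorial * N : ℕ) : ℤ),
        j.factorial * N ≠ 0 → n.factorial / j.factorial * (j.factorial * N) = n.factorial * N →
          ∀ (x : Fin g ⊕ Fin g → ZMod (j.factorial * N)) (u : Fin g ⊕ Fin g → ZMod (n.factorial * N)),
            (∀ k, (ZMod.cast (u k) : ZMod (j.factorial * N)) = x k) →
            ((L' (Multiplicative.ofAdd x)) : (A.fibre s).toAbelianVariety.Points Ω) =
              ((L (Multiplicative.ofAdd u)) : (A.fibre s).toAbelianVariety.Points Ω) ^ (n.factorial / j.factorial) :=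
      fun j => exists_monoidHom_powDown (A.fibre s).toAbelianVariety (n.factorial / j.factorial) (j.factorial * N)
        (n.factorial * N) L
    choose L' hL' using hex
    -- the canonical lift of a vector to the top level `N·n!`
    have hlift : ∀ (j : ℕ), j ≤ n → ∀ (x : Fin g ⊕ Fin g → ZMod (j.factorial * N)) (k : Fin g ⊕ Fin g),
        (ZMod.cast (((x k).val : ZMod (n.factorial * N))) : ZMod (j.factorial * N)) = x k := fun j hj x k => by
      haveI : NeZero (j.factorial * N) := ⟨hlev0 j⟩
      rw [ZMod.cast_natCast (mul_dvd_mul_right (Nat.factorial_dvd_factorial hj) N), ZMod.natCast_zmod_val]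
    have good : ∀ j, j ≤ n → Good j (ζ ^ (n.factorial / j.factorial)) (L' j) := fun j hj => by
      haveI : NeZero (j.factorial * N) := ⟨hlev0 j⟩
      refine ⟨IsPrimitiveRoot.pow (Nat.pos_of_ne_zero (hlev0 n)) hζ (hdlev j hj).symm,
        bijective_of_powDown (hdlev j hj) (hd0 j hj) (hlev0 j) hL (hL' j (hlev0 j) (hdlev j hj)), fun i => ?_,
        fun hMΩ x y => weilPairingLevel_powDown δ (hdlev j hj) (hd0 j hj) (hlev0 j) Θ hζ hpair
          (hL' j (hlev0 j) (hdlev j hj)) hMΩ x y⟩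
      rw [hL' j (hlev0 j) (hdlev j hj) (Pi.single i 1) (Pi.single i 1) fun k => ?_, ← pow_mul, hd j hj]
      · exact hlv i
      · rcases eq_or_ne k i with rfl | hk
        · rw [Pi.single_eq_same, Pi.single_eq_same, ZMod.cast_one (mul_dvd_mul_right (Nat.factorial_dvd_factorial hj) N)]
        · rw [Pi.single_eq_of_ne hk, Pi.single_eq_of_ne hk, ZMod.cast_zero]
    refine ⟨fun j => ⟨(ζ ^ (n.factorial / (j : ℕ).factorial), L' j), good j (Nat.le_of_lt_succ j.2)⟩, fun j hj => ?_⟩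
    have hj' : j + 1 ≤ n := Nat.le_of_lt_succ hj
    refine ⟨?_, fun x => ?_⟩
    · show (ζ ^ (n.factorial / (j + 1).factorial)) ^ (j + 1) = ζ ^ (n.factorial / j.factorial)
      rw [← pow_mul, hdS j hj']
    · show ((L' j (Multiplicative.ofAdd fun i => ZMod.castHom _ (ZMod (j.factorial * N)) (x i))) :
          (A.fibre s).toAbelianVariety.Points Ω) = ((L' (j + 1) (Multiplicative.ofAdd x)) : _) ^ (j + 1)
      haveI : NeZero (j.factorial * N) := ⟨hlev0 j⟩
      haveI : NeZero ((j + 1).factorial * N) := ⟨hlev0 (j + 1)⟩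
      rw [hL' (j + 1) (hlev0 (j + 1)) (hdlev (j + 1) hj') x (fun k => ((x k).val : ZMod (n.factorial * N)))
          (hlift (j + 1) hj' x),
        hL' j (hlev0 j) (hdlev j (Nat.le_of_succ_le hj')) _ (fun k => ((x k).val : ZMod (n.factorial * N)))
          fun k => ?_, ← pow_mul, hdS j hj']
      rw [ZMod.castHom_apply, ZMod.cast_natCast (mul_dvd_mul_right (Nat.factorial_dvd_factorial
          (Nat.le_of_succ_le hj')) N), ZMod.cast_eq_val]
  obtain ⟨D, hD⟩ := exists_seq_of_forall_exists_chain C hstr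
  exact ⟨fun j => (D j).1.1, fun j => (D j).1.2, fun j => (D j).2, fun j => hD j⟩

/-- **SPREADING STEP — a compatible chain on the levels `N·j!` gives a symplectic lift**: from `(ζ_j, L_j)_j` as in
`exists_chain_of_forall_level` define, at EVERY level `M ≥ 1`, `ζ'_M := ζ_M^{(M-1)!·N}` and `lift_M := [(M-1)!·N] ∘ L_M ∘
(lift to level N·M!)` (`M ∣ M!`, §1); primitivity, bijectivity and the similitude clause come down from level `N·M!` (§1),
and the tower compatibilities `ζ'_{kM}^k = ζ'_M`, `lift_M(x mod M) = lift_{kM}(x)^k` follow from the chain compatibilities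
iterated from `M` to `kM` and the exponent identity `(kM-1)!·N·k = ((kM)!/M!)·(M-1)!·N`; at `M = N`,
`lift_N(eᵢ) = L_N(eᵢ)^{(N-1)!·N} = L_N(eᵢ)^{N!} = σᵢ(s)`. [cite: Lan2013PELCompactifications, §1.3.6 Lemma 1.3.6.5 (p. 81)]
[cite: Deligne1971TravauxShimura, 4.12 (b) p. 149] -/
theorem nonempty_symplecticLift_of_chain (hN : N ≠ 0) (ζs : ℕ → Ω)
    (Ls : ∀ j : ℕ, Multiplicative (Fin g ⊕ Fin g → ZMod (j.factorial * N)) →*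
      (A.fibre s).toAbelianVariety.torsionPoints Ω ((j.factorial * N : ℕ) : ℤ))
    (hgood : ∀ j : ℕ, IsPrimitiveRoot (ζs j) (j.factorial * N) ∧ Function.Bijective (Ls j) ∧
        (∀ i : Fin g ⊕ Fin g,
          ((Ls j (Multiplicative.ofAdd (Pi.single i 1))) : (A.fibre s).toAbelianVariety.Points Ω) ^ j.factorial =
            A.restrictPt s (φ.σ i)) ∧
        ∀ (hMΩ : ((j.factorial * N : ℕ) : Ω) ≠ 0) (x y : Fin g ⊕ Fin g → ZMod (j.factorial * N)),
          haveI := AbelianVariety.isDominant_toSchemeHom_zsmul_of_ne_zero (A.fibre s).toAbelianVariety hMΩ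
          (A.fibre s).toAbelianVariety.weilPairingLevel Θ (Ls j (Multiplicative.ofAdd x)) (Ls j (Multiplicative.ofAdd y)) =
            ζs j ^ (typeFormMod δ (j.factorial * N) x y).val)
    (hcompat : ∀ j : ℕ, ζs (j + 1) ^ (j + 1) = ζs j ∧
        ∀ x : Fin g ⊕ Fin g → ZMod ((j + 1).factorial * N),
          ((Ls j (Multiplicative.ofAdd fun i => ZMod.castHom
              (mul_dvd_mul_right (Nat.factorial_dvd_factorial (Nat.le_succ j)) N) (ZMod (j.factorial * N)) (x i))) :
            (A.fibre s).toAbelianVariety.Points Ω) =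
          ((Ls (j + 1) (Multiplicative.ofAdd x)) : (A.fibre s).toAbelianVariety.Points Ω) ^ (j + 1)) :
    Nonempty (φ.SymplecticLift s Θ δ) := by
  classical
  have hlev0 : ∀ j : ℕ, j.factorial * N ≠ 0 := fun j => Nat.mul_ne_zero (Nat.factorial_ne_zero j) hN
  -- iterated compatibility along the chain, roots
  have hζle : ∀ j j' : ℕ, j ≤ j' → ζs j' ^ (j'.factorial / j.factorial) = ζs j := by
    intro j j' hjj'
    induction j', hjj' using Nat.le_induction with
    | base => rw [Nat.div_self (Nat.factorial_pos j), pow_one]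
    | succ j' hjj' ih =>
      rw [show (j' + 1).factorial / j.factorial = (j' + 1) * (j'.factorial / j.factorial) by
          rw [Nat.factorial_succ, Nat.mul_div_assoc _ (Nat.factorial_dvd_factorial hjj')],
        pow_mul, (hcompat j').1, ih]
  -- iterated compatibility along the chain, similitudes
  have hLle : ∀ (j j' : ℕ) (hjj' : j ≤ j') (w : Fin g ⊕ Fin g → ZMod (j'.factorial * N)),
      ((Ls j (Multiplicative.ofAdd fun k => ZMod.castHom
          (mul_dvd_mul_right (Nat.factorial_dvd_factorial hjj') N) (ZMod (j.factorial * N)) (w k))) :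
        (A.fibre s).toAbelianVariety.Points Ω) =
      ((Ls j' (Multiplicative.ofAdd w)) : (A.fibre s).toAbelianVariety.Points Ω) ^ (j'.factorial / j.factorial) := by
    intro j j' hjj'
    induction j', hjj' using Nat.le_induction with
    | base =>
      intro w
      rw [Nat.div_self (Nat.factorial_pos j), pow_one]
      congr 3
      funext k
      rw [ZMod.castHom_apply, ZMod.cast_id]
    | succ j' hjj' ih =>
      intro w
      have hw := ih fun k => ZMod.castHom (mul_dvd_mul_right (Nat.factorial_dvd_factorial (Nat.le_succ j')) N)
        (ZMod (j'.factorial * N)) (w k)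
      have hcomp : ∀ k, ZMod.castHom (mul_dvd_mul_right (Nat.factorial_dvd_factorial hjj') N)
          (ZMod (j.factorial * N)) (ZMod.castHom (mul_dvd_mul_right (Nat.factorial_dvd_factorial (Nat.le_succ j')) N)
            (ZMod (j'.factorial * N)) (w k)) =
          ZMod.castHom (mul_dvd_mul_right (Nat.factorial_dvd_factorial (Nat.le_succ_of_le hjj')) N)
            (ZMod (j.factorial * N)) (w k) := fun k => by
        rw [← RingHom.comp_apply, ZMod.castHom_comp]
      simp only [hcomp] at hw
      rw [hw, show (j' + 1).factorial / j.factorial = (j' + 1) * (j'.factorial / j.factorial) by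
          rw [Nat.factorial_succ, Nat.mul_div_assoc _ (Nat.factorial_dvd_factorial hjj')],
        pow_mul, ← (hcompat j').2 w]
  -- the exponent `(M-1)!·N` of the power-down from level `N·M!` to level `M`
  have hdM : ∀ M : ℕ, M ≠ 0 → (M - 1).factorial * N * M = M.factorial * N := fun M hM => by
    rw [mul_right_comm, mul_comm _ M, Nat.mul_factorial_pred hM]
  have hdM0 : ∀ M : ℕ, (M - 1).factorial * N ≠ 0 := fun M => Nat.mul_ne_zero (Nat.factorial_ne_zero _) hN
  have hex : ∀ M : ℕ, ∃ L' : Multiplicative (Fin g ⊕ Fin g → ZMod M) →*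
      (A.fibre s).toAbelianVariety.torsionPoints Ω (M : ℤ),
      M ≠ 0 → (M - 1).factorial * N * M = M.factorial * N →
        ∀ (x : Fin g ⊕ Fin g → ZMod M) (u : Fin g ⊕ Fin g → ZMod (M.factorial * N)),
          (∀ k, (ZMod.cast (u k) : ZMod M) = x k) →
          ((L' (Multiplicative.ofAdd x)) : (A.fibre s).toAbelianVariety.Points Ω) =
            ((Ls M (Multiplicative.ofAdd u)) : (A.fibre s).toAbelianVariety.Points Ω) ^ ((M - 1).factorial * N) :=
    fun M => exists_monoidHom_powDown (A.fibre s).toAbelianVariety ((M - 1).factorial * N) M (M.factorial * N) (Ls M)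
  choose lift hlift using hex
  -- `M ∣ N·M!`
  have hMdvd : ∀ M : ℕ, M ≠ 0 → M ∣ M.factorial * N := fun M hM =>
    (Nat.dvd_factorial (Nat.pos_of_ne_zero hM) le_rfl).mul_right N
  refine ⟨{ ζ := fun M => ζs M ^ ((M - 1).factorial * N)
            lift := lift
            isPrimitiveRoot_ζ := fun M _ hM0 =>
              IsPrimitiveRoot.pow (Nat.pos_of_ne_zero (hlev0 M)) (hgood M).1 (hdM M hM0).symm
            ζ_pow := fun M k _ hM0 hk0 => ?_
            lift_bijective := fun M _ hM0 =>
              bijective_of_powDown (hdM M hM0) (hdM0 M) hM0 (hgood M).2.1 (hlift M hM0 (hdM M hM0))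
            lift_compat := fun M k x _ hM0 hk0 => ?_
            lift_level := fun i => ?_
            pairing := fun M _ hMΩ x y => ?_ }⟩
  · -- `ζ'_{kM}^k = ζ'_M`
    have hkM0 : k * M ≠ 0 := Nat.mul_ne_zero hk0 hM0
    show (ζs (k * M) ^ ((k * M - 1).factorial * N)) ^ k = ζs M ^ ((M - 1).factorial * N)
    rw [← hζle M (k * M) (Nat.le_mul_of_pos_left M (Nat.pos_of_ne_zero hk0)), ← pow_mul, ← pow_mul,
      factorial_pred_mul_mul_eq hM0 hk0]
  · -- `lift_M (x mod M) = lift_{kM}(x)^k`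
    have hkM0 : k * M ≠ 0 := Nat.mul_ne_zero hk0 hM0
    haveI : NeZero M := ⟨hM0⟩
    haveI : NeZero (k * M) := ⟨hkM0⟩
    haveI : NeZero ((k * M).factorial * N) := ⟨hlev0 _⟩
    haveI : NeZero (M.factorial * N) := ⟨hlev0 _⟩
    have hle : M ≤ k * M := Nat.le_mul_of_pos_left M (Nat.pos_of_ne_zero hk0)
    -- the canonical lift `w` of `x` to the level `N·(kM)!`
    have hw : ∀ i, (ZMod.cast ((((x i).val : ZMod ((k * M).factorial * N)))) : ZMod (k * M)) = x i := fun i => by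
      rw [ZMod.cast_natCast (hMdvd (k * M) hkM0), ZMod.natCast_zmod_val]
    have hu : ∀ i, (ZMod.cast (ZMod.castHom (mul_dvd_mul_right (Nat.factorial_dvd_factorial hle) N)
        (ZMod (M.factorial * N)) (((x i).val : ZMod ((k * M).factorial * N)))) : ZMod M) =
        ZMod.castHom (Dvd.intro_left k rfl) (ZMod M) (x i) := fun i => by
      rw [ZMod.castHom_apply, ZMod.castHom_apply,
        ZMod.cast_natCast (mul_dvd_mul_right (Nat.factorial_dvd_factorial hle) N), ZMod.cast_natCast (hMdvd M hM0),
        ZMod.cast_eq_val]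
    rw [hlift (k * M) hkM0 (hdM _ hkM0) x _ hw, hlift M hM0 (hdM M hM0) _ _ hu, hLle M (k * M) hle, ← pow_mul, ← pow_mul,
      factorial_pred_mul_mul_eq hM0 hk0]
  · -- `lift_N(eᵢ) = σᵢ(s)`
    haveI : NeZero N := ⟨hN⟩
    have he : (N - 1).factorial * N = N.factorial := by rw [Nat.mul_comm, Nat.mul_factorial_pred hN]
    rw [hlift N hN (hdM N hN) (Pi.single i 1) (Pi.single i 1) fun k => ?_, he]
    · exact (hgood N).2.2.1 i
    · rcases eq_or_ne k i with rfl | hk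
      · rw [Pi.single_eq_same, Pi.single_eq_same, ZMod.cast_one (hMdvd N hN)]
      · rw [Pi.single_eq_of_ne hk, Pi.single_eq_of_ne hk, ZMod.cast_zero]
  · -- the similitude clause at level `M`
    have hM0 : M ≠ 0 := by rintro rfl; exact hMΩ (by rw [Nat.cast_zero])
    exact weilPairingLevel_powDown δ (hdM M hM0) (hdM0 M) hM0 Θ (hgood M).1 (hgood M).2.2.2
      (hlift M hM0 (hdM M hM0)) hMΩ x y

/-- **`φ(s)` HAS A SYMPLECTIC LIFT IFF IT LIFTS TO A SYMPLECTIC SIMILITUDE AT EVERY SINGLE LEVEL `kN`** (`N ≠ 0`): the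
compatible tower `Λ = (ζ_M, lift_M)_{N ∣ M}` of ★ `SymplecticLift` (= Lan's «symplectic isomorphism `α̂ : L ⊗ Ẑ ⥲ T A_s̄`
lifting `α_{n,s̄}`», Lemma 1.3.6.5, on the torsion tower) exists iff for every `k ≠ 0` there are a primitive `kN`-th root
`ζ` and a group isomorphism `L : (ℤ/kN)^{2g} ⥲ A_s[kN](Ω)` with `L(eᵢ)^k = σᵢ(s)` and `ē^Θ_{kN}(L x, L y) = ζ^{E_δ(x,y)}` —
NO compatibility between the levels is asked.  «⇒» forgets (`lift_compat` at `N ∣ kN` gives `L(eᵢ)^k = lift_N(eᵢ) =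
σᵢ(s)`); «⇐» is KÖNIG: on the chain of levels `N·n!` the truncated compatible towers (each level powered down from the
next, §1) form an inverse system of finite non-empty sets (§2), and a point of its limit is spread to every `M`, `N ∣ M`,
through the level `N·M!`. [cite: Lan2013PELCompactifications, §1.3.6 Lemma 1.3.6.5 (p. 81) and Lemma 1.3.6.6 (pp. 81–82)]
[cite: Deligne1971TravauxShimura, 4.12 (b) p. 149] -/
theorem nonempty_symplecticLift_iff_forall_level (hN : N ≠ 0) :
    Nonempty (φ.SymplecticLift s Θ δ) ↔
      ∀ k : ℕ, k ≠ 0 → ∃ (ζ : Ω) (L : Multiplicative (Fin g ⊕ Fin g → ZMod (k * N)) →*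
          (A.fibre s).toAbelianVariety.torsionPoints Ω ((k * N : ℕ) : ℤ)),
        IsPrimitiveRoot ζ (k * N) ∧ Function.Bijective L ∧
        (∀ i : Fin g ⊕ Fin g, ((L (Multiplicative.ofAdd (Pi.single i 1))) : (A.fibre s).toAbelianVariety.Points Ω) ^ k =
          A.restrictPt s (φ.σ i)) ∧
        ∀ (hMΩ : ((k * N : ℕ) : Ω) ≠ 0) (x y : Fin g ⊕ Fin g → ZMod (k * N)),
          haveI := AbelianVariety.isDominant_toSchemeHom_zsmul_of_ne_zero (A.fibre s).toAbelianVariety hMΩ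
          (A.fibre s).toAbelianVariety.weilPairingLevel Θ (L (Multiplicative.ofAdd x)) (L (Multiplicative.ofAdd y)) =
            ζ ^ (typeFormMod δ (k * N) x y).val := by
  classical
  constructor
  · -- «⇒»: forget the compatibilities
    rintro ⟨Λ⟩ k hk
    have hkN : N ∣ k * N := dvd_mul_left N k
    have hkN0 : k * N ≠ 0 := Nat.mul_ne_zero hk hN
    refine ⟨Λ.ζ (k * N), Λ.lift (k * N), Λ.isPrimitiveRoot_ζ hkN hkN0, Λ.lift_bijective hkN hkN0, fun i => ?_,
      fun hMΩ x y => Λ.pairing hkN hMΩ x y⟩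
    have hcast : (fun j => ZMod.castHom (Dvd.intro_left k rfl) (ZMod N)
        ((Pi.single i (1 : ZMod (k * N)) : Fin g ⊕ Fin g → ZMod (k * N)) j)) = Pi.single i 1 := by
      funext j
      rcases eq_or_ne j i with rfl | hj
      · rw [Pi.single_eq_same, Pi.single_eq_same, map_one]
      · rw [Pi.single_eq_of_ne hj, Pi.single_eq_of_ne hj, map_zero]
    rw [← Λ.lift_level i, ← hcast]
    exact (Λ.lift_compat k (Pi.single i 1) dvd_rfl hN hk).symm
  · -- «⇐»: König on the chain of levels `N·n!`, then spread
    intro h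
    obtain ⟨ζs, Ls, hgood, hcompat⟩ := φ.exists_chain_of_forall_level s Θ δ hN h
    exact φ.nonempty_symplecticLift_of_chain s Θ δ hN ζs Ls hgood hcompat

/-- **SYMPLECTIC-LIFTABILITY IS A LEVEL-BY-LEVEL CONDITION**: `φ` is symplectic-liftable of type `δ` for `pol` iff at
every geometric point `s`, for every ample witness `Θ` of the polarisation there, and at EVERY SINGLE LEVEL `kN` there is
a symplectic similitude `(ℤ/kN)^{2g} ⥲ A_s[kN](Ω)` lifting `φ(s)` (Lemma 1.3.6.6's pointwise criterion, unfolded one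
level at a time by König). [cite: Lan2013PELCompactifications, §1.3.6 Lemma 1.3.6.6 and Cor. 1.3.6.7 (pp. 81–82)] -/
theorem isSymplecticLiftable_iff_forall_level {D : A.DualPair} (pol : A.Polarization D) (hN : N ≠ 0) :
    φ.IsSymplecticLiftable pol δ ↔
      ∀ (Ω : Type u) [Field Ω] [IsAlgClosed Ω] (s : Spec (.of Ω) ⟶ S)
        (Θ : CartierDivisor (A.fibre s).toAbelianVariety.X.left), Θ.IsAmple → A.IsLambdaOfAt s D pol.lam Θ →
        ∀ k : ℕ, k ≠ 0 → ∃ (ζ : Ω) (L : Multiplicative (Fin g ⊕ Fin g → ZMod (k * N)) →*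
            (A.fibre s).toAbelianVariety.torsionPoints Ω ((k * N : ℕ) : ℤ)),
          IsPrimitiveRoot ζ (k * N) ∧ Function.Bijective L ∧
          (∀ i : Fin g ⊕ Fin g, ((L (Multiplicative.ofAdd (Pi.single i 1))) : (A.fibre s).toAbelianVariety.Points Ω) ^ k =
            A.restrictPt s (φ.σ i)) ∧
          ∀ (hMΩ : ((k * N : ℕ) : Ω) ≠ 0) (x y : Fin g ⊕ Fin g → ZMod (k * N)),
            haveI := AbelianVariety.isDominant_toSchemeHom_zsmul_of_ne_zero (A.fibre s).toAbelianVariety hMΩ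
            (A.fibre s).toAbelianVariety.weilPairingLevel Θ (L (Multiplicative.ofAdd x)) (L (Multiplicative.ofAdd y)) =
              ζ ^ (typeFormMod δ (k * N) x y).val := by
  refine forall_congr' fun Ω => forall_congr' fun _ => forall_congr' fun _ => forall_congr' fun s =>
    forall_congr' fun Θ => forall_congr' fun _ => forall_congr' fun _ => ?_
  exact φ.nonempty_symplecticLift_iff_forall_level s Θ δ hN

end LevelStructure

end AbelianSchemeOver

end Literature.AlgebraicGeometry.AbelianSchemes

end
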